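import Summits.Ventures.HSemireg.CocycleExtensionCompare
import Mathlib.Algebra.Homology.DerivedCategory.ShortExact
import HarnessLib

/-!
# Venture HSemireg — the EXTENSION-COMPARISON LEMMA in the derived category: `δ(S₂) = δ(S₁) + δ(ext w)`
# (gs-g4 gen 21, brick C4d of `general-structure/COMPLEX-LEIBNIZ-PLAN-gs-g4.md`)

HONEST FRAMING. Homological algebra on an arbitrary scheme `X` with a unit `1`-cocycle `c` and a derived category of
`X.Modules` (Mathlib `DerivedCategory.triangleOfSESδ`), continuing `CocycleExtensionCompare.lean`. Nothing about any
variety; nothing here says HC, HC_CM or HC_AV is proved. Intended use (sequel): `S₁ =` the Hodge-twisted Atiyah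
sequence of `E• ⊗ M` transported from that of `E•`, `S₂ =` the Atiyah sequence of `E• ⊗ M`, `w =` the wedge with the
logarithmic cocycle `dlog g_{xy}` — the Leibniz rule `At(E ⊗ M) = At(E) ⊗ 1 + 1 ⊗ [dlog c]` for complexes.

## Statement (everything proved)

`ExtensionCompare.triangleOfSESδ_eq_add`: let `S₁ = (B →ι₁ M₁ →π₁ A)` and `S₂ = (B →ι₂ M₂ →π₂ A)` be short exact
sequences of cochain complexes of `𝒪_X`-modules, `w` a local `1`-cocycle of complexes `A → B` (`LocalOneCocycleC`),
and `φ^i_x : M₁^i|_{U_x} → M₂^i|_{U_x}` local morphisms commuting with the differentials, with `ι₁| ≫ φ_x = ι₂|`,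
`φ_x ≫ π₂| = π₁|` and `φ_y| - φ_x| = π₁| ≫ w_{xy} ≫ ι₂|` on `V ⊆ U_x ∩ U_y`. Then the connecting morphisms in `D(X)`
satisfy **`δ(S₂) = δ(S₁) + δ(0 → B → extC w → A → 0)`** as morphisms `Q A → (Q B)⟦1⟧`.

Proof: the short exact sequence `0 → K → Y → A → 0` (`Y = extC w̃`, `K = extC 0`) maps to `S₁`, to the cocycle
extension and to `S₂` with first components `π_K`, `ρ`, `π_K + ρ` (`CocycleExtensionCompare`), and
`triangleOfSESδ_naturality` is additive in the first component.

## References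

* [Har77] R. Hartshorne, *Algebraic Geometry*, GTM 52 (1977), III Ex. 4.5; Mathlib `DerivedCategory.triangleOfSESδ`.
-/

noncomputable section

set_option backward.isDefEq.respectTransparency false

open CategoryTheory CategoryTheory.Limits AlgebraicGeometry TopologicalSpace Opposite

namespace Summit.Ventures.HSemireg

open Literature.AlgebraicGeometry.Modules Literature.AlgebraicGeometry.HodgeTheory CocycleTwist

universe w' u

variable {X : Scheme.{u}} {c : UnitCocycle X}

namespace ExtensionCompare

variable {A B M₁ M₂ : CochainComplex X.Modules ℤ} (ι₁ : B ⟶ M₁) (π₁ : M₁ ⟶ A) (ι₂ : B ⟶ M₂) (π₂ : M₂ ⟶ A)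
  (w : LocalOneCocycleC c A B) (φ : ∀ (i : ℤ) (x : X), (M₁.X i).over (c.U x) ⟶ (M₂.X i).over (c.U x))
  (hφ : ∀ (i : ℤ) (x y : X) (V : X.Opens) (hx : V ≤ c.U x) (hy : V ≤ c.U y),
    restrictHom (homOfLE hy) (φ i y) - restrictHom (homOfLE hx) (φ i x) =
      (SheafOfModules.overFunctor _ V).map (π₁.f i) ≫ (w.w i).w x y V hx hy ≫
        (SheafOfModules.overFunctor _ V).map (ι₂.f i))
  (hφd : ∀ (i j : ℤ) (x : X), φ i x ≫ (SheafOfModules.overFunctor _ (c.U x)).map (M₂.d i j) =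
    (SheafOfModules.overFunctor _ (c.U x)).map (M₁.d i j) ≫ φ j x)

/-! ### The chain maps -/

include hφd in
/-- **`ψ• : Y = extC w̃ ⟶ M₂`**, termwise the glued `ψ` (a chain map: checked over the cover). [folklore] -/
def ψC : CocycleExtension.extC (w.precomp π₁) ⟶ M₂ where
  f i := ψ (π₁.f i) (ι₂.f i) (w.w i) (φ i) (hφ i)
  comm' i j _ := by
    refine hom_ext_of_cover c fun x => ?_
    rw [Functor.map_comp, Functor.map_comp, restrict_ψ, CocycleExtension.extC_d]
    change ψLoc (π₁.f i) (ι₂.f i) (w.w i) (φ i) x ≫ _ =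
      (SheafOfModules.overFunctor _ (c.U x)).map (CocycleExtension.map ((w.w i).precomp (π₁.f i))
        ((w.w j).precomp (π₁.f j)) (M₁.d i j) (B.d i j) ((w.precomp π₁).comm i j)) ≫
        (SheafOfModules.overFunctor _ (c.U x)).map (ψ (π₁.f j) (ι₂.f j) (w.w j) (φ j) (hφ j))
    rw [restrict_ψ, ψLoc, ψLoc, Preadditive.add_comp, Category.assoc, Category.assoc, hφd,
      ← (SheafOfModules.overFunctor _ (c.U x)).map_comp (ι₂.f i) (M₂.d i j), ι₂.comm i j,
      (SheafOfModules.overFunctor _ (c.U x)).map_comp (B.d i j) (ι₂.f j), Preadditive.comp_add,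
      ← (SheafOfModules.overFunctor _ (c.U x)).map_comp_assoc (CocycleExtension.map _ _ _ _ _)
        (CocycleExtension.π _) (φ j x), CocycleExtension.map_π, Functor.map_comp_assoc]
    simp only [← Category.assoc]
    rw [CocycleExtension.map_ret]

/-- Components of `ψ•`. [folklore] -/
theorem ψC_f (i : ℤ) : (ψC π₁ ι₂ w φ hφ hφd).f i = ψ (π₁.f i) (ι₂.f i) (w.w i) (φ i) (hφ i) := rfl

/-- `ι₁^i ≫ π₁^i = 0`. [folklore] -/
theorem comp_f_eq_zero (h₁ : ι₁ ≫ π₁ = 0) (i : ℤ) : ι₁.f i ≫ π₁.f i = 0 := by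
  rw [← HomologicalComplex.comp_f, h₁, HomologicalComplex.zero_f]

/-- **`incl• : K = extC 0 ⟶ Y`**, termwise `incl`. [folklore] -/
def inclC (h₁ : ι₁ ≫ π₁ = 0) :
    CocycleExtension.extC (0 : LocalOneCocycleC c B B) ⟶ CocycleExtension.extC (w.precomp π₁) :=
  CocycleExtension.mapC 0 (w.precomp π₁) ι₁ (𝟙 B) fun i => by
    simpa only [HomologicalComplex.id_f, LocalOneCocycleC.precomp_w, LocalOneCocycleC.zero_w'] using
      incl_compat (ι₁.f i) (π₁.f i) (w.w i) (comp_f_eq_zero ι₁ π₁ h₁ i)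

/-- Components of `incl•`. [folklore] -/
theorem inclC_f (h₁ : ι₁ ≫ π₁ = 0) (i : ℤ) : (inclC ι₁ π₁ w h₁).f i = incl (ι₁.f i) (π₁.f i) (w.w i) (comp_f_eq_zero ι₁ π₁ h₁ i) := by
  rw [inclC, CocycleExtension.mapC_f, incl]
  exact CocycleExtension.map_congr _ _ rfl (HomologicalComplex.id_f B i) _ _

/-- **`χ• : Y ⟶ extC w`**, termwise `χ`. [folklore] -/
def χC : CocycleExtension.extC (w.precomp π₁) ⟶ CocycleExtension.extC w :=
  CocycleExtension.mapC (w.precomp π₁) w π₁ (𝟙 B) fun i => by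
    simpa only [HomologicalComplex.id_f, LocalOneCocycleC.precomp_w] using χ_compat (π₁.f i) (w.w i)

/-- Components of `χ•`. [folklore] -/
theorem χC_f (i : ℤ) : (χC π₁ w).f i = χ (π₁.f i) (w.w i) := by
  rw [χC, CocycleExtension.mapC_f, χ]
  exact CocycleExtension.map_congr _ _ rfl (HomologicalComplex.id_f B i) _ _

/-- `incl• ≫ π_Y• ≫ π₁ = 0`. [folklore] -/
theorem inclC_πC_π₁ (h₁ : ι₁ ≫ π₁ = 0) : inclC ι₁ π₁ w h₁ ≫ CocycleExtension.πC (w.precomp π₁) ≫ π₁ = 0 := by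
  rw [← Category.assoc, inclC, CocycleExtension.mapC_πC, Category.assoc, h₁, Limits.comp_zero]

/-- **The short exact sequence `0 → K → Y → A → 0` of complexes.** [folklore] -/
abbrev KYA (h₁ : ι₁ ≫ π₁ = 0) : ShortComplex (CochainComplex X.Modules ℤ) :=
  ShortComplex.mk (inclC ι₁ π₁ w h₁) (CocycleExtension.πC (w.precomp π₁) ≫ π₁) (inclC_πC_π₁ ι₁ π₁ w h₁)

/-- `0 → K → Y → A → 0` is short exact (degreewise `shortExact_KYA`). [folklore] -/
theorem shortExact_KYAC (h₁ : ι₁ ≫ π₁ = 0) (hS₁ : (ShortComplex.mk ι₁ π₁ h₁).ShortExact) : (KYA ι₁ π₁ w h₁).ShortExact := by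
  refine HomologicalComplex.shortExact_of_degreewise_shortExact _ fun i => ?_
  have hi : (ShortComplex.mk (ι₁.f i) (π₁.f i) (comp_f_eq_zero ι₁ π₁ h₁ i)).ShortExact :=
    hS₁.map_of_exact (HomologicalComplex.eval _ _ i)
  exact shortExact_KYA (ι₁.f i) (π₁.f i) (w.w i) (comp_f_eq_zero ι₁ π₁ h₁ i) hi

/-! ### The three morphisms of short exact sequences out of `0 → K → Y → A → 0` -/

/-- Towards `S₁`: `(π_K, π_Y, 𝟙)`. [folklore] -/
def toS₁ (h₁ : ι₁ ≫ π₁ = 0) : KYA ι₁ π₁ w h₁ ⟶ ShortComplex.mk ι₁ π₁ h₁ where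
  τ₁ := CocycleExtension.πC (0 : LocalOneCocycleC c B B)
  τ₂ := CocycleExtension.πC (w.precomp π₁)
  τ₃ := 𝟙 A
  comm₁₂ := by
    dsimp only
    rw [inclC, CocycleExtension.mapC_πC]
  comm₂₃ := by
    dsimp only
    rw [Category.comp_id]

/-- Towards the cocycle extension `0 → B → extC w → A → 0`: `(ρ, χ, 𝟙)`. [folklore] -/
def toR (h₁ : ι₁ ≫ π₁ = 0) : KYA ι₁ π₁ w h₁ ⟶ CocycleExtension.shortComplexC w where
  τ₁ := CocycleExtension.ρC c B B
  τ₂ := χC π₁ w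
  τ₃ := 𝟙 A
  comm₁₂ := by
    dsimp only
    refine HomologicalComplex.hom_ext _ _ fun i => ?_
    rw [HomologicalComplex.comp_f, HomologicalComplex.comp_f, inclC_f, χC_f, incl_χ, CocycleExtension.ρC_f,
      CocycleExtension.ιC_f]
  comm₂₃ := by
    dsimp only
    rw [Category.comp_id, χC, CocycleExtension.mapC_πC]

include hφd in
/-- Towards `S₂`: `(π_K + ρ, ψ, 𝟙)`. [folklore] -/
def toS₂ (h₁ : ι₁ ≫ π₁ = 0) (h₂ : ι₂ ≫ π₂ = 0) (hφι : ∀ (i : ℤ) (x : X), (SheafOfModules.overFunctor _ (c.U x)).map (ι₁.f i) ≫ φ i x =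
      (SheafOfModules.overFunctor _ _).map (ι₂.f i))
    (hφπ : ∀ (i : ℤ) (x : X), φ i x ≫ (SheafOfModules.overFunctor _ (c.U x)).map (π₂.f i) =
      (SheafOfModules.overFunctor _ _).map (π₁.f i)) :
    KYA ι₁ π₁ w h₁ ⟶ ShortComplex.mk ι₂ π₂ h₂ where
  τ₁ := CocycleExtension.πC (0 : LocalOneCocycleC c B B) + CocycleExtension.ρC c B B
  τ₂ := ψC π₁ ι₂ w φ hφ hφd
  τ₃ := 𝟙 A
  comm₁₂ := by
    dsimp only
    refine HomologicalComplex.hom_ext _ _ fun i => ?_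
    rw [HomologicalComplex.comp_f, HomologicalComplex.comp_f, inclC_f, ψC_f,
      incl_ψ (ι₁.f i) (π₁.f i) (ι₂.f i) (w.w i) (φ i) (hφ i) (hφι i), HomologicalComplex.add_f_apply,
      CocycleExtension.πC_f, CocycleExtension.ρC_f]
    rfl
  comm₂₃ := by
    dsimp only
    rw [Category.comp_id]
    refine HomologicalComplex.hom_ext _ _ fun i => ?_
    rw [HomologicalComplex.comp_f, HomologicalComplex.comp_f, ψC_f, CocycleExtension.πC_f]
    exact ψ_π (π₁.f i) (ι₂.f i) (π₂.f i) (w.w i) (φ i) (hφ i) (hφπ i) (comp_f_eq_zero ι₂ π₂ h₂ i)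

/-! ### The comparison of connecting morphisms -/

variable [HasDerivedCategory.{w'} X.Modules]

include hφ hφd in
/-- **EXTENSION-COMPARISON LEMMA: `δ(S₂) = δ(S₁) + δ(0 → B → extC w → A → 0)`** in `D(X)`, for two short exact
sequences of complexes `B → M_i → A` related by local morphisms `φ_x` whose overlap differences are the cocycle `w`
(`φ_y| - φ_x| = π₁| ≫ w_{xy} ≫ ι₂|`). [cite: Hartshorne1977, III Ex. 4.5 (Baer sum via cocycles)] -/
theorem triangleOfSESδ_eq_add (h₁ : ι₁ ≫ π₁ = 0) (h₂ : ι₂ ≫ π₂ = 0) (hS₁ : (ShortComplex.mk ι₁ π₁ h₁).ShortExact)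
    (hS₂ : (ShortComplex.mk ι₂ π₂ h₂).ShortExact)
    (hφι : ∀ (i : ℤ) (x : X), (SheafOfModules.overFunctor _ (c.U x)).map (ι₁.f i) ≫ φ i x =
      (SheafOfModules.overFunctor _ _).map (ι₂.f i))
    (hφπ : ∀ (i : ℤ) (x : X), φ i x ≫ (SheafOfModules.overFunctor _ (c.U x)).map (π₂.f i) =
      (SheafOfModules.overFunctor _ _).map (π₁.f i)) :
    DerivedCategory.triangleOfSESδ hS₂ =
      DerivedCategory.triangleOfSESδ hS₁ + DerivedCategory.triangleOfSESδ (CocycleExtension.shortExactC w) := by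
  have hT := shortExact_KYAC ι₁ π₁ w h₁ hS₁
  have e₁ := DerivedCategory.triangleOfSESδ_naturality hT hS₁ (toS₁ ι₁ π₁ w h₁)
  have e₂ := DerivedCategory.triangleOfSESδ_naturality hT (CocycleExtension.shortExactC w) (toR ι₁ π₁ w h₁)
  have e₃ := DerivedCategory.triangleOfSESδ_naturality hT hS₂ (toS₂ ι₁ π₁ ι₂ π₂ w φ hφ hφd h₁ h₂ hφι hφπ)
  have i₁ : DerivedCategory.Q.map (toS₁ ι₁ π₁ w h₁).τ₃ = 𝟙 _ := DerivedCategory.Q.map_id _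
  have i₂ : DerivedCategory.Q.map (toR ι₁ π₁ w h₁).τ₃ = 𝟙 _ := DerivedCategory.Q.map_id _
  have i₃ : DerivedCategory.Q.map (toS₂ ι₁ π₁ ι₂ π₂ w φ hφ hφd h₁ h₂ hφι hφπ).τ₃ = 𝟙 _ := DerivedCategory.Q.map_id _
  rw [i₁, Category.id_comp] at e₁
  rw [i₂, Category.id_comp] at e₂
  rw [i₃, Category.id_comp] at e₃
  rw [← e₁, ← e₂, ← e₃]
  change _ ≫ (DerivedCategory.Q.map (CocycleExtension.πC 0 + CocycleExtension.ρC c B B))⟦(1 : ℤ)⟧' =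
    _ ≫ (DerivedCategory.Q.map (CocycleExtension.πC 0))⟦(1 : ℤ)⟧' +
      _ ≫ (DerivedCategory.Q.map (CocycleExtension.ρC c B B))⟦(1 : ℤ)⟧'
  rw [Functor.map_add, Functor.map_add, Preadditive.comp_add]

end ExtensionCompare

end Summit.Ventures.HSemireg

end
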